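import Summits.ResolutionOfSingularities.ResolutionOfSingularities.Theorems.PurelyInseparableDim4KeptMultiplicity
import Summits.ResolutionOfSingularities.ResolutionOfSingularities.Theorems.PurelyInseparableDim4Target
import Summits.ResolutionOfSingularities.ResolutionOfSingularities.Theorems.PurelyInseparableDim4Rules
import HarnessLib

/-!
# [OURS · res-dim4-pi PR-4K, part 2] Lemma K in the cell's words: the presentation invariant
  «clean ∧ `r` re-read on `exc`» along every edge and every branch of every mode

Cell `res-dim4-pi` (D-0157 DOOR 2, wave 2), brick **PR-4K** part 2 (part 1 =
`PurelyInseparableDim4KeptMultiplicity.lean`: Lemma K over the tree's `CentreBlowup.step`, any `σ`), seat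
`res-dim4-p-6`.  Stated over the landed cell frame `PurelyInseparableDim4Target` / `…Rules` (`State K =
CState (Fin 4) K`, `IsPermissibleCentre`, `Edge`, `Step0 / Step1h / Step2 / StepHP / StepRule`); no definition.

* `clean_of_edge` (the model cleans at every step), **`reread_of_edge`**: along every `Edge q S s s'` in a
  Hironaka-permissible coordinate centre from a clean state, if `r_i = ord_{(x_i)} F` for every `i ∈ exc`
  before, then after (the new component by part 1's `step_r_self_eq_toNat_ordAlong`, the kept ones by
  LEMMA K, the lost ones having left `exc`); `ordAlong_singleton_step_of_isPermissibleCentre` (chart and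
  point named: kept `ord_{(x_i)} F′ = ord_{(x_i)} F`, new `ord_{(x_j)} F′ = ord_{C_S} F − q`).
* `step2_of_step1h / _stepHP / _step0 / _stepRule`: every mode's step is a MODE-2 step, so
  **`reread_of_step2_chain` / `reread_of_step2_branch`**: if the root of a finite or infinite MODE-2 sequence
  is clean with `r` re-read on `exc` (a census root: `F` clean, `exc = Δ`, `r_i = ord_{(x_i)} F`), then so is
  EVERY state of it — the engines' re-read multiplicities and the tree's `newMult` agree letter for letter
  along all logged edges, translated (`t ≠ 0`) or not; the tree's Moh `+1` referee
  (`CentreBlowup.mohBound_one`, `…shade_le_shade_add_one_along`) and the `Φ¹` checksum statements thus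
  speak about the engines' `(F, r, Δ)` verbatim.

[OURS · counted 0 · elementary · AI kernel work, weaker than expert review.]  NOTHING here is a statement
about resolution of singularities; resolution in dimension `≥ 4` / characteristic `p > 0` is NOT proved by
anything in this file.  bears_on: LADDER-RESOLUTION:D157-DOOR2 (res-dim4-pi · PR-4K).  Host item (DR-157-C):
`stmt-ResolutionOfSingularities-16155` (`MarkedTransfer.HypersurfaceOrderReduction`), helper.
-/

noncomputable section

set_option linter.dupNamespace false -- mandated namespace of this single-conjunct summit

open MvPolynomial Finset

namespace Summit.ResolutionOfSingularities.ResolutionOfSingularities.Theorems.PIDim4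

namespace KeptMultiplicity

open Literature.AlgebraicGeometry.Resolution
open Literature.AlgebraicGeometry.Resolution.CentreBlowup
open Literature.AlgebraicGeometry.Resolution.Hauser2010

/-! ## The presentation invariant along edges and branches -/

section Cell

variable {K : Type} [Field K] [DecidableEq K]

omit [DecidableEq K] in
/-- Condition (1) in support form from the cell's `IsPermissibleCentre` (p-3's
`NearDim.forall_le_degIn_of_le_ordAlong`). [cite: HauserPerlega2019PRIMS, §2 (condition (1) f ∈ P^{c!})] -/
theorem forall_le_degIn_of_isPermissibleCentre {q : ℕ} {S : Finset (Fin 4)} {F : MvPolynomial (Fin 4) K}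
    (h : IsPermissibleCentre q S F) : ∀ e ∈ F.support, q ≤ CentreBlowup.degIn S e :=
  NearDim.forall_le_degIn_of_le_ordAlong h.2

/-- **Cleanliness is preserved along every edge** (the model cleans at every step: tree
`CentreBlowup.deletePthPowers_step`). [cite: Hauser2010, §G (cleaning)] -/
theorem clean_of_edge {q : ℕ} {S : Finset (Fin 4)} {s s' : State K} (hedge : Edge q S s s') :
    deletePthPowers q s'.F = s'.F := by
  obtain ⟨j, b, -, -, -, -, rfl⟩ := hedge
  exact deletePthPowers_step q S j b s

/-- **The re-read invariant is preserved along every edge in a Hironaka-permissible coordinate centre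
from a clean state**: if `r_i = ord_{(x_i)} F` on `exc` before the edge, then after it.  (Every edge of
MODE 0 / 1h / 2 / HP and of every permissible rule is such an edge.) OURS (Lemma K in the cell's words).
[cite: Hauser2010, §F (transform D' of the exceptional divisor)] -/
theorem reread_of_edge {q : ℕ} {S : Finset (Fin 4)} {s s' : State K}
    (hperm : IsPermissibleCentre q S s.F) (hclean : deletePthPowers q s.F = s.F) (hedge : Edge q S s s')
    (hread : ∀ i ∈ s.exc, s.r i = (CentreBlowup.ordAlong {i} s.F).toNat) :
    ∀ i ∈ s'.exc, s'.r i = (CentreBlowup.ordAlong {i} s'.F).toNat := by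
  obtain ⟨j, b, hj, hbj, -, -, rfl⟩ := hedge
  exact forall_exc_step_r_eq_toNat_ordAlong hj b hbj s hclean
    (forall_le_degIn_of_isPermissibleCentre hperm) hread

/-- **Lemma K along an edge, kept component named**: for an edge realised by the chart `j` and the point
`b` (`s' = step q S j b s`), every kept index `i ≠ j`, `b_i = 0` has `ord_{(x_i)} F′ = ord_{(x_i)} F`, and
the new component has `ord_{(x_j)} F′ = ord_{C_S} F − q`. OURS (elementary).
[cite: Hauser2010, §F (transform D' of the exceptional divisor)] -/
theorem ordAlong_singleton_step_of_isPermissibleCentre {q : ℕ} {S : Finset (Fin 4)} {j : Fin 4}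
    (hj : j ∈ S) (b : Fin 4 → K) (hbj : b j = 0) (s : State K) (hperm : IsPermissibleCentre q S s.F)
    (hclean : deletePthPowers q s.F = s.F) :
    (∀ i, i ≠ j → b i = 0 →
        CentreBlowup.ordAlong {i} (CentreBlowup.step q S j b s).F = CentreBlowup.ordAlong {i} s.F) ∧
      CentreBlowup.ordAlong {j} (CentreBlowup.step q S j b s).F = CentreBlowup.ordAlong S s.F - q :=
  ⟨fun _ hij hbi => ordAlong_singleton_step_of_kept hj b s hclean
      (forall_le_degIn_of_isPermissibleCentre hperm) hij hbi,
    ordAlong_singleton_step_self hj b hbj s hclean (forall_le_degIn_of_isPermissibleCentre hperm)⟩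

/-- A MODE-2 step is a permissible-centre edge; so are the steps of MODE 1h, MODE HP and of every
permissible rule (by their definitions) and MODE 0 (`univ` is non-empty). [folklore] -/
theorem step2_of_step1h {q : ℕ} {s s' : State K} (h : Step1h q s s') : Step2 q s s' := by
  obtain ⟨S, hS, hE⟩ := h
  exact ⟨S, hS.1, hE⟩

/-- A MODE-HP step is a MODE-2 step. [folklore] -/
theorem step2_of_stepHP {q : ℕ} {s s' : State K} (h : StepHP q s s') : Step2 q s s' := by
  obtain ⟨S, hS, -, hE⟩ := h
  exact ⟨S, hS, hE⟩

/-- A MODE-0 step is a MODE-2 step (the point `univ` is a permissible centre). [folklore] -/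
theorem step2_of_step0 {q : ℕ} {s s' : State K} (h : Step0 q s s') : Step2 q s s' :=
  ⟨Finset.univ, ⟨Finset.univ_nonempty, h.1⟩, h.2⟩

/-- A step of a rule at a state where the chosen centre is permissible is a MODE-2 step. [folklore] -/
theorem step2_of_stepRule {q : ℕ} {R : CentreRule K} {s s' : State K} (h : StepRule q R s s') :
    Step2 q s s' :=
  ⟨R s, h.1, h.2⟩

/-- **The presentation invariant along every MODE-2 branch**: if the root of a (finite or infinite)
sequence of MODE-2 steps is clean with `r` re-read on `exc` (e.g. a root configuration of the census:
`F` clean, `exc = Δ`, `r_i = ord_{(x_i)} F`), then EVERY state of the branch is clean with `r` re-read on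
`exc` — the engines' re-read multiplicities and the tree's `newMult` agree letter for letter along all
logged edges, translated (`t ≠ 0`) or not.  By `step2_of_step1h / _stepHP / _step0 / _stepRule` the same
holds for every mode of the census. OURS (elementary). [cite: Hauser2010, §F (transform D' of the exceptional divisor)] -/
theorem reread_of_step2_chain {q : ℕ} (c : ℕ → State K) (n : ℕ)
    (hstep : ∀ k < n, Step2 q (c k) (c (k + 1)))
    (hclean₀ : deletePthPowers q (c 0).F = (c 0).F)
    (hread₀ : ∀ i ∈ (c 0).exc, (c 0).r i = (CentreBlowup.ordAlong {i} (c 0).F).toNat) :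
    ∀ k ≤ n, deletePthPowers q (c k).F = (c k).F ∧
      ∀ i ∈ (c k).exc, (c k).r i = (CentreBlowup.ordAlong {i} (c k).F).toNat := by
  intro k hk
  induction k with
  | zero => exact ⟨hclean₀, hread₀⟩
  | succ k ih =>
    obtain ⟨hc, hr⟩ := ih (Nat.le_of_succ_le hk)
    obtain ⟨S, hperm, hedge⟩ := hstep k (Nat.lt_of_succ_le hk)
    exact ⟨clean_of_edge hedge, reread_of_edge hperm hc hedge hr⟩

/-- The same along an INFINITE MODE-2 branch: every stage is clean with `r` re-read on `exc`.
OURS (elementary). [cite: Hauser2010, §F (transform D' of the exceptional divisor)] -/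
theorem reread_of_step2_branch {q : ℕ} (c : ℕ → State K) (hstep : ∀ k, Step2 q (c k) (c (k + 1)))
    (hclean₀ : deletePthPowers q (c 0).F = (c 0).F)
    (hread₀ : ∀ i ∈ (c 0).exc, (c 0).r i = (CentreBlowup.ordAlong {i} (c 0).F).toNat) (k : ℕ) :
    deletePthPowers q (c k).F = (c k).F ∧
      ∀ i ∈ (c k).exc, (c k).r i = (CentreBlowup.ordAlong {i} (c k).F).toNat :=
  reread_of_step2_chain c k (fun m _ => hstep m) hclean₀ hread₀ k le_rfl

end Cell

end KeptMultiplicity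

end Summit.ResolutionOfSingularities.ResolutionOfSingularities.Theorems.PIDim4

end
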